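import Literature.Computability.Cryptography.OneSidedTrialsPromiseBQP
import Literature.Computability.Complexity.DivisorIndexFP
import Literature.Computability.Complexity.MurrayWilliams2018MachineB
import Literature.Computability.QuantumComplexity.BQPJoinClosure
import Literature.Algebra.EuclideanLattices.IntegerMatrixInverseMachine
import Summits.QuantumAdvantage.QuantumAdvantage.Theorems.ArithStatLadderAvgFaceBeyondPriorCertUnitMemBQP
import HarnessLib

/-!
# Crux `ArithStatLadder.IqThreeMemBQP` (stmt-QuantumAdvantage-2424), line `scholz-mirror-siegel` — the real trial program (support of stub S6b)

Support file of the registered stub `stub_realWitnessOfParts` (S6b). ONE TRIAL of the real torsion-witness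
sampler as an adaptive `FP` program over the join `FG ⊕ L` of the factor bit-graph language `FG ∈ BQP`
(`factorGraph_mem_BQP`, Shor) and an arbitrary language `L` (later: `L₅ = VALID ∩ {3 ∣ ord}`): on `⟨x, z⟩`
with `d = ⟦x⟧`, `D = D⁺(d)` (`d/3` or `3d`), `d₀ = mirrorRadicand d`, `ℓ = size ⌊√D⌋ + 1`, `k = 12 · size |x|`:
read `b = ⟦z ↾ ℓ⟧`, `j = ⟦(z ⇂ ℓ) ↾ k⟧`, `M = (D − b²)/4`, obtain `primeFactorsList M` from `FG`
(`AdPres.batch` + un-padding, as in `adPres_graph`), decode the divisor `a = dec (primeFactorsList M) j`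
(`CodeFP.exists_divisorIndex`, mixed radix), and ask `L` ONCE at `⟨bin d₀, ⟨bin fmtA, bin fmtR⟩⟩`,
`(fmtA, fmtR) = (a, b/2)` if `4 ∣ D` else `(2a, b)`. Exported definition-free as `trial_exists`: a function
`tq : {0,1}* → {0,1}* → {0,1}*` with (1) `{w | tq (fst w) (snd w) ∈ L} ∈ BQP` for every `L ∈ BQP`
(`mem_BQP_of_adPres_bit`, `oracleJoin_mem_BQP`), (2) every query names `d₀`, (3) every divisor `a` of
`M_b ≠ 0` is hit by some index `j < τ(M_b)`.
-/

set_option linter.dupNamespace false -- D-0017: single-problem summit ⇒ QuantumAdvantage.QuantumAdvantage by design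

noncomputable section

namespace Summit.QuantumAdvantage.QuantumAdvantage.Theorems.ArithStatLadder.IqThreeMemBQP

open scoped nonZeroDivisors
open _root_.Computability Polynomial
open Literature.Computability.Complexity Literature.Computability.Complexity.Brick
open Literature.Computability.Complexity.CodeFP Literature.Computability.Complexity.AdQuery
open Literature.Computability.Cryptography Literature.Computability.QuantumComplexity
open Literature.NumberTheory.QuadraticFields
open Literature.Computability.Complexity.Knapsack (decNatList canonLFn canonLFn_eq canonLFn_mem_FP decNatList_encode)

/-! ### Small `CodeFP` facts -/

/-- `D⁺(d) = d/3` or `3d` is computed on codes. [folklore] -/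
theorem codeFP_mirrorDisc : CodeFP natE natE (fun d => if 3 ∣ d then d / 3 else 3 * d) := by
  refine ((natEq.comp ((natMod.comp ((CodeFP.id _).pair (const _ 3))).pair (const _ 0))).ite
    (natDiv.comp ((CodeFP.id _).pair (const _ 3))) (natMul.comp ((const _ 3).pair (CodeFP.id _)))).congr fun d => ?_
  by_cases h : 3 ∣ d
  · simp [h, Nat.dvd_iff_mod_eq_zero.1 h]
  · have h' : d % 3 ≠ 0 := fun h' => h (Nat.dvd_of_mod_eq_zero h')
    simp [h, h']

/-! ### The arithmetic of a trial, on codes -/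

section TrialCode

/-- The trial's `D = D⁺(⟦x⟧)` on codes. [cite: AroraBarak2009, §1.3] -/
theorem codeFP_trialD : CodeFP strE natE (fun w =>
    (if 3 ∣ bitsToNat (fstF w) then bitsToNat (fstF w) / 3 else 3 * bitsToNat (fstF w))) :=
  codeFP_mirrorDisc.comp (strVal.comp ⟨fstF, fstF_mem_FP, fun _ => rfl⟩)

/-- The trial's `ℓ = size ⌊√D⌋ + 1` on codes. [cite: AroraBarak2009, §1.3] -/
theorem codeFP_trialL : CodeFP strE natE (fun w =>
    (Nat.sqrt (if 3 ∣ bitsToNat (fstF w) then bitsToNat (fstF w) / 3 else 3 * bitsToNat (fstF w))).size + 1) := by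
  have cs : CodeFP strE natE (fun w =>
      (Nat.sqrt (if 3 ∣ bitsToNat (fstF w) then bitsToNat (fstF w) / 3 else 3 * bitsToNat (fstF w))).size) :=
    (SatCode.natSize_code.comp (natSqrt.comp codeFP_trialD)).congr fun _ => rfl
  exact (natAdd.comp (cs.pair (const _ 1))).congr fun _ => rfl

/-- The trial's `b = ⟦z ↾ ℓ⟧` on codes. [cite: AroraBarak2009, §1.3] -/
theorem codeFP_trialB : CodeFP strE natE (fun w => bitsToNat ((sndF w).take
    ((Nat.sqrt (if 3 ∣ bitsToNat (fstF w) then bitsToNat (fstF w) / 3 else 3 * bitsToNat (fstF w))).size + 1))) := by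
  have cz : CodeFP strE strE sndF := ⟨sndF, sndF_mem_FP, fun _ => rfl⟩
  have cu : CodeFP strE unE (fun w => min ((Nat.sqrt (if 3 ∣ bitsToNat (fstF w) then bitsToNat (fstF w) / 3
      else 3 * bitsToNat (fstF w))).size + 1) (sndF w).length) :=
    (unOfNatMin.comp ((strLength.comp cz).pair codeFP_trialL)).congr fun _ => rfl
  exact (strVal.comp (strTake.comp (cu.pair cz))).congr fun w => by simp only [Literature.Algebra.EuclideanLattices.GSInverse.take_min_length]

/-- The trial's `M = (D − b²)/4` on codes. [cite: AroraBarak2009, §1.3] -/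
theorem codeFP_trialM : CodeFP strE natE (fun w =>
    ((if 3 ∣ bitsToNat (fstF w) then bitsToNat (fstF w) / 3 else 3 * bitsToNat (fstF w)) -
      bitsToNat ((sndF w).take ((Nat.sqrt (if 3 ∣ bitsToNat (fstF w) then bitsToNat (fstF w) / 3
        else 3 * bitsToNat (fstF w))).size + 1)) ^ 2) / 4) := by
  have cbb : CodeFP strE natE (fun w => bitsToNat ((sndF w).take ((Nat.sqrt (if 3 ∣ bitsToNat (fstF w) then
      bitsToNat (fstF w) / 3 else 3 * bitsToNat (fstF w))).size + 1)) ^ 2) :=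
    (natMul.comp (codeFP_trialB.pair codeFP_trialB)).congr fun w => by simp only [sq]
  have csub : CodeFP strE natE (fun w => (if 3 ∣ bitsToNat (fstF w) then bitsToNat (fstF w) / 3 else 3 * bitsToNat (fstF w)) -
      bitsToNat ((sndF w).take ((Nat.sqrt (if 3 ∣ bitsToNat (fstF w) then bitsToNat (fstF w) / 3
        else 3 * bitsToNat (fstF w))).size + 1)) ^ 2) :=
    (natSub.comp (codeFP_trialD.pair cbb)).congr fun _ => rfl
  exact (natDiv.comp (csub.pair (const _ 4))).congr fun _ => rfl

/-- **The factor query maker** (`FP`): `⟨w, bin i⟩ ↦ 0·⟨bin M(w), bin i⟩` (bit `i` of the padded code of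
`primeFactorsList M`, asked to the factor bit-graph language on the left of the join). [cite: AroraBarak2009, §3.4] -/
theorem trialF1_exists : ∃ f₁ : List Bool → List Bool, f₁ ∈ FP ∧ ∀ (w : List Bool) (i : ℕ),
    f₁ (boolPair w (encodeNat i)) = false :: boolPair (encodeNat
      (((if 3 ∣ bitsToNat (fstF w) then bitsToNat (fstF w) / 3 else 3 * bitsToNat (fstF w)) -
        bitsToNat ((sndF w).take ((Nat.sqrt (if 3 ∣ bitsToNat (fstF w) then bitsToNat (fstF w) / 3
          else 3 * bitsToNat (fstF w))).size + 1)) ^ 2) / 4)) (encodeNat i) := by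
  have cP := ((codeFP_trialM.comp (fst strE natE)).pair (snd strE natE)).recodeOut (eγ := strE) fun _ => rfl
  have cC : CodeFP strE strE (List.cons false) := ⟨List.cons false, cons_mem_FP false, fun _ => rfl⟩
  obtain ⟨f, hf, hfs⟩ := cC.comp cP
  refine ⟨f, hf, fun w i => ?_⟩
  have := hfs (w, i)
  simp only [pairE_apply, strE, natE, id] at this
  exact this

variable (dec : List ℕ → ℕ → ℕ)

/-- **The class-order query maker** (`FP`), given a divisor decoder `dec` computed on codes:
`⟨w, code L⟩ ↦ 1·⟨bin d₀, ⟨bin fmtA, bin fmtR⟩⟩` with `a = dec L j`. [cite: AroraBarak2009, §3.4] -/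
theorem trialF2_exists (hdec : CodeFP (pairE (rawE natE) natE) natE (fun Lj => dec Lj.1 Lj.2)) :
    ∃ f₂ : List Bool → List Bool, f₂ ∈ FP ∧ ∀ (w s : List Bool),
    f₂ (boolPair w s) = true :: boolPair (encodeNat (mirrorRadicand (bitsToNat (fstF w))))
      (boolPair
        (encodeNat (if 4 ∣ (if 3 ∣ bitsToNat (fstF w) then bitsToNat (fstF w) / 3 else 3 * bitsToNat (fstF w)) then
          dec (decNatList s) (bitsToNat (((sndF w).drop ((Nat.sqrt (if 3 ∣ bitsToNat (fstF w) then
            bitsToNat (fstF w) / 3 else 3 * bitsToNat (fstF w))).size + 1)).take (12 * (fstF w).length.size)))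
         else 2 * dec (decNatList s) (bitsToNat (((sndF w).drop ((Nat.sqrt (if 3 ∣ bitsToNat (fstF w) then
            bitsToNat (fstF w) / 3 else 3 * bitsToNat (fstF w))).size + 1)).take (12 * (fstF w).length.size)))))
        (encodeNat (if 4 ∣ (if 3 ∣ bitsToNat (fstF w) then bitsToNat (fstF w) / 3 else 3 * bitsToNat (fstF w)) then
          bitsToNat ((sndF w).take ((Nat.sqrt (if 3 ∣ bitsToNat (fstF w) then bitsToNat (fstF w) / 3
            else 3 * bitsToNat (fstF w))).size + 1)) / 2
         else bitsToNat ((sndF w).take ((Nat.sqrt (if 3 ∣ bitsToNat (fstF w) then bitsToNat (fstF w) / 3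
            else 3 * bitsToNat (fstF w))).size + 1))))) := by
  -- pieces on `t = (w, s)`
  have cW : CodeFP (pairE strE strE) strE Prod.fst := fst _ _
  have cz : CodeFP (pairE strE strE) strE (fun t => sndF t.1) := ⟨sndF ∘ fstF, comp_mem_FP sndF_mem_FP fstF_mem_FP,
    fun t => by simp⟩
  have cL : CodeFP (pairE strE strE) (rawE natE) (fun t => decNatList t.2) :=
    (rawOfList natE).comp ⟨canonLFn ∘ sndF, comp_mem_FP canonLFn_mem_FP sndF_mem_FP, fun t => by
      simp only [Function.comp_apply, pairE_apply, sndF_boolPair, canonLFn_eq]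
      rw [show (encodingListNatBool.encode : List ℕ → List Bool) = listE natE from listE_eq encodingNatBool]; rfl⟩
  have cD := codeFP_trialD.comp cW
  have cl := codeFP_trialL.comp cW
  have cb := codeFP_trialB.comp cW
  have ck : CodeFP (pairE strE strE) natE (fun t => 12 * (fstF t.1).length.size) :=
    (natMul.comp ((const _ 12).pair (SatCode.natSize_code.comp (strNatLength.comp
      (CodeFP.comp (β := List Bool) (eβ := strE) ⟨fstF, fstF_mem_FP, fun _ => rfl⟩ cW))))).congr fun _ => rfl
  have cdrop : CodeFP (pairE strE strE) strE (fun t => (sndF t.1).drop ((Nat.sqrt (if 3 ∣ bitsToNat (fstF t.1) then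
      bitsToNat (fstF t.1) / 3 else 3 * bitsToNat (fstF t.1))).size + 1)) :=
    (strDrop.comp ((unOfNatMin.comp ((strLength.comp cz).pair cl)).pair cz)).congr fun t => by
      simp only [Literature.Algebra.EuclideanLattices.GSInverse.drop_min_length]
  have cj : CodeFP (pairE strE strE) natE (fun t => bitsToNat (((sndF t.1).drop ((Nat.sqrt (if 3 ∣ bitsToNat (fstF t.1)
      then bitsToNat (fstF t.1) / 3 else 3 * bitsToNat (fstF t.1))).size + 1)).take (12 * (fstF t.1).length.size))) :=
    (strVal.comp (strTake.comp ((unOfNatMin.comp ((strLength.comp cdrop).pair ck)).pair cdrop))).congr fun t => by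
      simp only [Literature.Algebra.EuclideanLattices.GSInverse.take_min_length]
  have ca : CodeFP (pairE strE strE) natE (fun t => dec (decNatList t.2) (bitsToNat (((sndF t.1).drop ((Nat.sqrt
      (if 3 ∣ bitsToNat (fstF t.1) then bitsToNat (fstF t.1) / 3 else 3 * bitsToNat (fstF t.1))).size + 1)).take
        (12 * (fstF t.1).length.size)))) := (hdec.comp (cL.pair cj)).congr fun _ => rfl
  have c4 : CodeFP (pairE strE strE) bitE (fun t => decide ((if 3 ∣ bitsToNat (fstF t.1) then bitsToNat (fstF t.1) / 3
      else 3 * bitsToNat (fstF t.1)) % 4 = 0)) := (natEq.comp ((natMod.comp (cD.pair (const _ 4))).pair (const _ 0))).congr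
        fun _ => rfl
  have cA := c4.ite ca (natMul.comp ((const _ 2).pair ca))
  have cR := c4.ite (natDiv.comp (cb.pair (const _ 2))) cb
  have cd0 : CodeFP (pairE strE strE) natE (fun t => mirrorRadicand (bitsToNat (fstF t.1))) :=
    (AvgFaceBeyondPrior.Mirror.codeFP_mirrorRadicand.comp (strVal.comp (CodeFP.comp (β := List Bool) (eβ := strE)
      ⟨fstF, fstF_mem_FP, fun _ => rfl⟩ cW))).congr fun _ => rfl
  have cQ := (cd0.pair (cA.pair cR)).recodeOut (eγ := strE) fun _ => rfl
  have cC : CodeFP strE strE (List.cons true) := ⟨List.cons true, cons_mem_FP true, fun _ => rfl⟩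
  obtain ⟨f, hf, hfs⟩ := cC.comp cQ
  refine ⟨f, hf, fun w s => ?_⟩
  have := hfs (w, s)
  simp only [pairE_apply, strE, natE, id] at this
  rw [this]
  simp only [Nat.dvd_iff_mod_eq_zero, decide_eq_true_eq]

/-- **The trial decides a `BQP` language** against any `L ∈ BQP`: run `f₁` as ONE batch over the join
`FG ⊕ L` (bits of the padded code of `primeFactorsList M`), un-pad, and ask `L` once through `f₂`; the final bit
is the oracle's answer, so `mem_BQP_of_adPres_bit` applies (`BQP^BQP = BQP`). [cite: AroraBarak2009, §10; BBBV1997, §4] -/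
theorem trial_mem_BQP (hdec : CodeFP (pairE (rawE natE) natE) natE (fun Lj => dec Lj.1 Lj.2))
    {L : Language Bool} (hL : L ∈ BQP) :
    {w : List Bool | boolPair (encodeNat (mirrorRadicand (bitsToNat (fstF w))))
      (boolPair
        (encodeNat (if 4 ∣ (if 3 ∣ bitsToNat (fstF w) then bitsToNat (fstF w) / 3 else 3 * bitsToNat (fstF w)) then
          dec (((if 3 ∣ bitsToNat (fstF w) then bitsToNat (fstF w) / 3 else 3 * bitsToNat (fstF w)) - bitsToNat ((sndF w).take ((Nat.sqrt (if 3 ∣ bitsToNat (fstF w) then bitsToNat (fstF w) / 3 else 3 * bitsToNat (fstF w))).size + 1)) ^ 2) / 4).primeFactorsList (bitsToNat (((sndF w).drop ((Nat.sqrt (if 3 ∣ bitsToNat (fstF w) then bitsToNat (fstF w) / 3 else 3 * bitsToNat (fstF w))).size + 1)).take (12 * (fstF w).length.size)))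
         else 2 * dec (((if 3 ∣ bitsToNat (fstF w) then bitsToNat (fstF w) / 3 else 3 * bitsToNat (fstF w)) - bitsToNat ((sndF w).take ((Nat.sqrt (if 3 ∣ bitsToNat (fstF w) then bitsToNat (fstF w) / 3 else 3 * bitsToNat (fstF w))).size + 1)) ^ 2) / 4).primeFactorsList (bitsToNat (((sndF w).drop ((Nat.sqrt (if 3 ∣ bitsToNat (fstF w) then bitsToNat (fstF w) / 3 else 3 * bitsToNat (fstF w))).size + 1)).take (12 * (fstF w).length.size)))))
        (encodeNat (if 4 ∣ (if 3 ∣ bitsToNat (fstF w) then bitsToNat (fstF w) / 3 else 3 * bitsToNat (fstF w)) then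
          bitsToNat ((sndF w).take ((Nat.sqrt (if 3 ∣ bitsToNat (fstF w) then bitsToNat (fstF w) / 3 else 3 * bitsToNat (fstF w))).size + 1)) / 2
         else bitsToNat ((sndF w).take ((Nat.sqrt (if 3 ∣ bitsToNat (fstF w) then bitsToNat (fstF w) / 3 else 3 * bitsToNat (fstF w))).size + 1))))) ∈ L} ∈ BQP := by
  classical
  obtain ⟨f₁, hf₁, hf₁s⟩ := trialF1_exists
  obtain ⟨f₂, hf₂, hf₂s⟩ := trialF2_exists dec hdec
  obtain ⟨post, hpost, hposts⟩ := unpad_exists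
  set FL : Language Bool := {u : List Bool | ∃ (x : List Bool) (i : ℕ), u = boolPair x (encodeNat i) ∧
    ((encodingListNatBool.encode (decodeNat x).primeFactorsList).flatMap (fun b => [true, b])).getD i false = true}
    with hFLdef
  set J : Language Bool := oracleJoin FL L with hJ
  have hJm : J ∈ BQP := oracleJoin_mem_BQP factorGraph_mem_BQP hL
  have hst₁ := AdPres.batch (A := J) hf₁ (2 * (2 * (Polynomial.X + 4) ^ 2))
  have hT := (AdPres.query (A := J) hf₂).comp (hst₁.FP_comp hpost)
  have hB := mem_BQP_of_adPres_bit (bit := fun w => L.boolIndicator (boolPair (encodeNat (mirrorRadicand (bitsToNat (fstF w))))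
          (boolPair
            (encodeNat (if 4 ∣ (if 3 ∣ bitsToNat (fstF w) then bitsToNat (fstF w) / 3 else 3 * bitsToNat (fstF w)) then
              dec (((if 3 ∣ bitsToNat (fstF w) then bitsToNat (fstF w) / 3 else 3 * bitsToNat (fstF w)) - bitsToNat ((sndF w).take ((Nat.sqrt (if 3 ∣ bitsToNat (fstF w) then bitsToNat (fstF w) / 3 else 3 * bitsToNat (fstF w))).size + 1)) ^ 2) / 4).primeFactorsList (bitsToNat (((sndF w).drop ((Nat.sqrt (if 3 ∣ bitsToNat (fstF w) then bitsToNat (fstF w) / 3 else 3 * bitsToNat (fstF w))).size + 1)).take (12 * (fstF w).length.size)))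
             else 2 * dec (((if 3 ∣ bitsToNat (fstF w) then bitsToNat (fstF w) / 3 else 3 * bitsToNat (fstF w)) - bitsToNat ((sndF w).take ((Nat.sqrt (if 3 ∣ bitsToNat (fstF w) then bitsToNat (fstF w) / 3 else 3 * bitsToNat (fstF w))).size + 1)) ^ 2) / 4).primeFactorsList (bitsToNat (((sndF w).drop ((Nat.sqrt (if 3 ∣ bitsToNat (fstF w) then bitsToNat (fstF w) / 3 else 3 * bitsToNat (fstF w))).size + 1)).take (12 * (fstF w).length.size)))))
            (encodeNat (if 4 ∣ (if 3 ∣ bitsToNat (fstF w) then bitsToNat (fstF w) / 3 else 3 * bitsToNat (fstF w)) then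
              bitsToNat ((sndF w).take ((Nat.sqrt (if 3 ∣ bitsToNat (fstF w) then bitsToNat (fstF w) / 3 else 3 * bitsToNat (fstF w))).size + 1)) / 2
             else bitsToNat ((sndF w).take ((Nat.sqrt (if 3 ∣ bitsToNat (fstF w) then bitsToNat (fstF w) / 3 else 3 * bitsToNat (fstF w))).size + 1))))))) hT hJm fun w => ?_
  · refine (Set.ext fun w => ?_ : _ = {w : List Bool | _}) ▸ hB
    exact (Set.mem_iff_boolIndicator _ _).symm
  -- the answers of the factor side
  set M : ℕ := (((if 3 ∣ bitsToNat (fstF w) then bitsToNat (fstF w) / 3 else 3 * bitsToNat (fstF w)) - bitsToNat ((sndF w).take ((Nat.sqrt (if 3 ∣ bitsToNat (fstF w) then bitsToNat (fstF w) / 3 else 3 * bitsToNat (fstF w))).size + 1)) ^ 2) / 4) with hM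
  set s := encodingListNatBool.encode M.primeFactorsList with hs
  have hFL : ∀ i : ℕ, J.boolIndicator (f₁ (boolPair w (encodeNat i))) = (s.flatMap fun b => [true, b]).getD i false := by
    intro i
    rw [hf₁s]
    have hiff : false :: boolPair (encodeNat M) (encodeNat i) ∈ J ↔ (s.flatMap fun b => [true, b]).getD i false = true := by
      rw [hJ, Literature.Computability.Complexity.false_cons_mem_oracleJoin]
      constructor
      · rintro ⟨x', i', h, hb⟩
        obtain ⟨h1, h2⟩ := Prod.mk.inj (Literature.Computability.Complexity.boolPair_injective
          (show Function.uncurry boolPair (encodeNat M, encodeNat i) = Function.uncurry boolPair (x', encodeNat i') from h))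
        rw [show i = i' from by simpa using congrArg decodeNat h2, hs, ← decode_encodeNat M, h1]; exact hb
      · exact fun hb => ⟨encodeNat M, i, rfl, by rwa [decode_encodeNat]⟩
    by_cases h : false :: boolPair (encodeNat M) (encodeNat i) ∈ J
    · rw [(Set.mem_iff_boolIndicator _ _).1 h, eq_comm]; exact hiff.1 h
    · rw [(Set.notMem_iff_boolIndicator _ _).1 h, eq_comm, ← Bool.not_eq_true]; exact fun hb => h (hiff.2 hb)
  -- the size of `M`
  have hMlt : M < 2 ^ (w.length + 2) := by
    have hd : bitsToNat (fstF w) < 2 ^ w.length :=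
      (bitsToNat_lt _).trans_le (Nat.pow_le_pow_right two_pos (by have := length_fstF_sndF_le w; omega))
    have hD : (if 3 ∣ bitsToNat (fstF w) then bitsToNat (fstF w) / 3 else 3 * bitsToNat (fstF w)) ≤ 3 * bitsToNat (fstF w) := by
      split_ifs
      · exact (Nat.div_le_self _ _).trans (Nat.le_mul_of_pos_left _ (by norm_num))
      · exact le_rfl
    have hM' : M ≤ (if 3 ∣ bitsToNat (fstF w) then bitsToNat (fstF w) / 3 else 3 * bitsToNat (fstF w)) := (Nat.div_le_self _ _).trans (Nat.sub_le _ _)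
    rw [pow_add]; omega
  have hlen : (encodeNat M).length ≤ w.length + 2 := by
    rw [TM2Pass.length_encodeNat_eq_size]; exact Nat.size_le.2 hMlt
  -- stage 1 and un-padding
  have hmid : post (boolPair w ((List.range ((2 * (2 * (Polynomial.X + 4) ^ 2) : Polynomial ℕ).eval
      w.length)).map fun i => J.boolIndicator (f₁ (boolPair w (encodeNat i))))) = boolPair w s := by
    rw [hposts, List.length_map, List.length_range]
    simp only [hFL]
    have hP : s.length ≤ (2 * (Polynomial.X + 4) ^ 2 : Polynomial ℕ).eval w.length := by
      have h := length_encode_primeFactorsList_le (encodeNat M)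
      rw [decode_encodeNat] at h
      refine h.trans ?_
      simp only [Polynomial.eval_mul, Polynomial.eval_pow, Polynomial.eval_add, Polynomial.eval_X, Polynomial.eval_ofNat]
      exact Nat.mul_le_mul_left 2 (Nat.pow_le_pow_left (by omega) 2)
    rw [show (2 * (2 * (Polynomial.X + 4) ^ 2) : Polynomial ℕ).eval w.length =
      2 * ((2 * (Polynomial.X + 4) ^ 2 : Polynomial ℕ).eval w.length) by simp [Polynomial.eval_mul],
      Nat.mul_div_cancel_left _ two_pos, unpad_eq s hP]
  have hqs : decNatList s = M.primeFactorsList := by rw [hs, decNatList_encode]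
  simp only [Function.comp_apply]
  rw [hmid, hf₂s w s, hJ, boolIndicator_oracleJoin_true_cons, hqs]

end TrialCode

/-- **The real trial, definition-free.** There is a query map `tq` such that (1) for every `L ∈ BQP` the trial
language `{w | tq (fst w) (snd w) ∈ L}` is in `BQP`; (2) every query names the mirror radicand `d₀` of `d = ⟦x⟧`;
(3) on `x = bin d`, for every `b` and every divisor `a` of `M_b = (D − b²)/4 ≠ 0` some index `j < τ(M_b)` makes
the coins `z` with `⟦z ↾ ℓ⟧ = b`, `⟦(z ⇂ ℓ) ↾ k⟧ = j` query `⟨bin d₀, ⟨bin fmtA, bin fmtR⟩⟩`.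
[cite: AroraBarak2009, §10; JacobsonWilliams2008, Thm. 5.8] -/
theorem trial_exists : ∃ tq : List Bool → List Bool → List Bool,
    (∀ L : Language Bool, L ∈ BQP → {w : List Bool | tq (fstF w) (sndF w) ∈ L} ∈ BQP) ∧
    (∀ x z : List Bool, ∃ u v : ℕ,
      tq x z = boolPair (encodeNat (mirrorRadicand (bitsToNat x))) (boolPair (encodeNat u) (encodeNat v))) ∧
    (∀ d b a : ℕ, ((if 3 ∣ d then d / 3 else 3 * d) - b ^ 2) / 4 ≠ 0 → a ∣ ((if 3 ∣ d then d / 3 else 3 * d) - b ^ 2) / 4 →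
      ∃ j : ℕ, j < ((((if 3 ∣ d then d / 3 else 3 * d) - b ^ 2) / 4).divisors.card) ∧ ∀ z : List Bool,
        bitsToNat (z.take ((Nat.sqrt (if 3 ∣ d then d / 3 else 3 * d)).size + 1)) = b →
        bitsToNat ((z.drop ((Nat.sqrt (if 3 ∣ d then d / 3 else 3 * d)).size + 1)).take (12 * (encodeNat d).length.size)) = j →
        tq (encodeNat d) z = boolPair (encodeNat (mirrorRadicand d))
          (boolPair (encodeNat (if 4 ∣ (if 3 ∣ d then d / 3 else 3 * d) then a else 2 * a)) (encodeNat (if 4 ∣ (if 3 ∣ d then d / 3 else 3 * d) then b / 2 else b)))) := by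
  obtain ⟨dec, hdec, hspec⟩ := CodeFP.exists_divisorIndex
  refine ⟨fun x z => boolPair (encodeNat (mirrorRadicand (bitsToNat x)))
        (boolPair
          (encodeNat (if 4 ∣ (if 3 ∣ bitsToNat x then bitsToNat x / 3 else 3 * bitsToNat x) then
            dec (((if 3 ∣ bitsToNat x then bitsToNat x / 3 else 3 * bitsToNat x) - bitsToNat (z.take ((Nat.sqrt (if 3 ∣ bitsToNat x then bitsToNat x / 3 else 3 * bitsToNat x)).size + 1)) ^ 2) / 4).primeFactorsList (bitsToNat ((z.drop ((Nat.sqrt (if 3 ∣ bitsToNat x then bitsToNat x / 3 else 3 * bitsToNat x)).size + 1)).take (12 * x.length.size)))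
           else 2 * dec (((if 3 ∣ bitsToNat x then bitsToNat x / 3 else 3 * bitsToNat x) - bitsToNat (z.take ((Nat.sqrt (if 3 ∣ bitsToNat x then bitsToNat x / 3 else 3 * bitsToNat x)).size + 1)) ^ 2) / 4).primeFactorsList (bitsToNat ((z.drop ((Nat.sqrt (if 3 ∣ bitsToNat x then bitsToNat x / 3 else 3 * bitsToNat x)).size + 1)).take (12 * x.length.size)))))
          (encodeNat (if 4 ∣ (if 3 ∣ bitsToNat x then bitsToNat x / 3 else 3 * bitsToNat x) then
            bitsToNat (z.take ((Nat.sqrt (if 3 ∣ bitsToNat x then bitsToNat x / 3 else 3 * bitsToNat x)).size + 1)) / 2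
           else bitsToNat (z.take ((Nat.sqrt (if 3 ∣ bitsToNat x then bitsToNat x / 3 else 3 * bitsToNat x)).size + 1))))), fun L hL => ?_, fun x z => ⟨_, _, rfl⟩,
    fun d b a hM ha => ?_⟩
  · beta_reduce
    exact trial_mem_BQP dec hdec hL
  obtain ⟨j, hj, hdj⟩ := hspec _ hM a ha
  refine ⟨j, hj, fun z hb hjz => ?_⟩
  simp only [bitsToNat_encodeNat]
  rw [hb, hjz, hdj]


end Summit.QuantumAdvantage.QuantumAdvantage.Theorems.ArithStatLadder.IqThreeMemBQP

end
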